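import Literature.LinearAlgebra.Matrix.BlockCentralizerDisjointSpectra     -- ★ Sylvester with a polynomial witness: `eq_zero_of_mul_eq_mul_of_aeval'`
import Literature.LinearAlgebra.Matrix.RegularSemisimpleConjClassClosed     -- ★ `continuous_charpoly_coeff`
import Mathlib.Topology.Instances.Matrix
import HarnessLib

/-!
# WEYL SEPARATION AT A SINGULAR SEMISIMPLE POINT: near the block scalar `ε = a·1 ⊕ u·1` (`a ≠ u`), an intertwiner `y M = M′ y` of two BLOCK-DIAGONAL matrices
# `M, M′` is itself block diagonal — so `y m y⁻¹ = m′` with `m, m′ ∈ Z(ε)` near `ε` forces `y ∈ Z(ε)` (N6nsGerm (S1)∕(S2), brick (W-s))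

Topic `LinearAlgebra/Matrix`; namespace `Literature.LinearAlgebra.Matrix`. THEOREMS ONLY (no definition, no named fact, no instance, no notation, no `sorry`).
Cell `pub/hodgecm-mathlib` (LEAD F0P3a-plan (g9) WORD T8-38 (1), road «N6nsGerm» of A-p12 (g18), census `CENSUS-N6nsGerm-S1.A-p16g26.md` brick (W-s)): the
Weyl-separation input of Harish-Chandra's descent at the singular semisimple point `ε` (the analogue, for the SLICE through the centraliser GROUP `Z(ε)`, of ★
`CharpolyLocalRigidity.eventually_mem_centralizer_of_conj_eq` for regular tori).  NO eigenvalues, NO factorisation uniqueness: Horn–Johnson's Sylvester criterion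
with a POLYNOMIAL witness (★ `BlockCentralizerDisjointSpectra.eq_zero_of_mul_eq_mul_of_aeval'`): if `y (A ⊕ D) = (A′ ⊕ D′) y` and `χ_D(A′)`, `χ_A(D′)` are INVERTIBLE then
the off-diagonal blocks of `y` vanish (`χ_D(D) = 0`, `χ_A(A) = 0`, Cayley–Hamilton); and «`χ_{D}(A′)` invertible» is an OPEN condition in `(A′, D)` holding at
`(a·1, u·1)` where it reads `(a − u)^{|o|} ≠ 0`.

* §1 `toBlocks_offDiag_eq_zero_of_mul_fromBlocks_eq` — the algebraic core over any field.
* §2 `continuous_aeval_charpoly`, `isOpen_setOf_isUnit_aeval_charpoly` (topological field, `T₁`), `isUnit_aeval_charpoly_smul_one` (the base point).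
* §3 **`eventually_toBlocks_offDiag_eq_zero_of_mul_eq`** — `∀ᶠ (M, M′)` near `(ε, ε)`: `M, M′` block diagonal ∧ `y M = M′ y` ⇒ `y` block diagonal; and the GROUP reading
  **`eventually_conj_toBlocks_offDiag_eq_zero`**: `y * M * y⁻¹ = M′` (`y ∈ GL`) ⇒ `y` block diagonal; and the FRAME form the Rogawski files consume
  **`eventually_commute_of_mul_eq_of_frame`** (`ε P = P · reindex e e (a·1 ⊕ u·1)`): near `(ε, ε)`, `M, M′ ∈ C(ε)` and `y M = M′ y` ⇒ `y ∈ C(ε)`.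

HONEST SCOPE. Linear algebra over a topological field. HC_CM is proved only modulo the printed citations until rung 0 closes; this file discharges no printed statement.

## References
* [HornJohnson2013] R. A. Horn, C. R. Johnson, *Matrix Analysis*, 2nd ed. (2013), §2.4.4 (Thm. 2.4.4.1, Cor. 2.4.4.2: Sylvester's equation and block-diagonal intertwiners).
* [Borel1991] A. Borel, *Linear Algebraic Groups*, 2nd ed. (1991), III.9.1 (centralisers of semisimple elements).
* [Rogawski1990] J. Rogawski, *Automorphic Representations of Unitary Groups in Three Variables* (1990), §8.2 Prop. 8.2.1 pp. 112–116 (descent at `γ₀ = a·1₂ ⊕ b`).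
-/

set_option autoImplicit false

open Polynomial Filter Topology

namespace Literature.LinearAlgebra.Matrix

variable {K : Type*} [Field K] {m o : Type*} [Fintype m] [DecidableEq m] [Fintype o] [DecidableEq o]

/-! ## §1 The algebraic core: intertwiners of block-diagonal matrices with Sylvester-separated blocks are block diagonal -/

/-- **`y (A ⊕ D) = (A′ ⊕ D′) y` with `χ_D(A′)` and `χ_A(D′)` invertible ⇒ `y` is block diagonal.** (Blockwise: `A′ y₁₂ = y₁₂ D`, `D′ y₂₁ = y₂₁ A`; ★ Sylvester with the
polynomial witnesses `χ_D`, `χ_A`, Cayley–Hamilton.) [cite: HornJohnson2013, §2.4.4 Cor. 2.4.4.2] -/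
theorem toBlocks_offDiag_eq_zero_of_mul_fromBlocks_eq {A A' : Matrix m m K} {D D' : Matrix o o K} {y : Matrix (m ⊕ o) (m ⊕ o) K}
    (h : y * Matrix.fromBlocks A 0 0 D = Matrix.fromBlocks A' 0 0 D' * y)
    (h₁ : IsUnit (aeval A' D.charpoly)) (h₂ : IsUnit (aeval D' A.charpoly)) :
    y.toBlocks₁₂ = 0 ∧ y.toBlocks₂₁ = 0 := by
  rw [← Matrix.fromBlocks_toBlocks y, Matrix.fromBlocks_multiply, Matrix.fromBlocks_multiply] at h
  obtain ⟨-, h12, h21, -⟩ := Matrix.fromBlocks_inj.1 h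
  simp only [Matrix.mul_zero, Matrix.zero_mul, add_zero, zero_add] at h12 h21
  exact ⟨eq_zero_of_mul_eq_mul_of_aeval' (Matrix.aeval_self_charpoly D) h₁ h12.symm,
    eq_zero_of_mul_eq_mul_of_aeval' (Matrix.aeval_self_charpoly A) h₂ h21.symm⟩

/-! ## §2 «`χ_D(A′)` is invertible» is open, and holds at the block scalar point -/

section Topology

variable [TopologicalSpace K] [IsTopologicalRing K]

/-- `(A′, D) ↦ χ_D(A′)` is continuous (finite sum `Σ_k coeff_k(χ_D) • A′^k`; ★ `continuous_charpoly_coeff`). [cite: HornJohnson2013, §2.4.4] -/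
theorem continuous_aeval_charpoly : Continuous fun q : Matrix m m K × Matrix o o K => aeval q.1 q.2.charpoly := by
  have h : ∀ q : Matrix m m K × Matrix o o K, aeval q.1 q.2.charpoly = ∑ i ∈ Finset.range (Fintype.card o + 1), q.2.charpoly.coeff i • q.1 ^ i :=
    fun q => aeval_eq_sum_range' (by rw [Matrix.charpoly_natDegree_eq_dim]; exact Nat.lt_succ_self _) _
  simp_rw [h]
  exact continuous_finsetSum _ fun i _ => ((continuous_charpoly_coeff i).comp continuous_snd).smul (continuous_fst.pow i)

variable [T1Space K]

/-- **`{(A′, D) | χ_D(A′) invertible}` is open** (`= {det χ_D(A′) ≠ 0}`). [cite: HornJohnson2013, §2.4.4] -/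
theorem isOpen_setOf_isUnit_aeval_charpoly : IsOpen {q : Matrix m m K × Matrix o o K | IsUnit (aeval q.1 q.2.charpoly)} := by
  have hset : {q : Matrix m m K × Matrix o o K | IsUnit (aeval q.1 q.2.charpoly)} =
      (fun q : Matrix m m K × Matrix o o K => (aeval q.1 q.2.charpoly).det) ⁻¹' {0}ᶜ := by
    ext q
    simp only [Set.mem_setOf_eq, Set.mem_preimage, Set.mem_compl_iff, Set.mem_singleton_iff, Matrix.isUnit_iff_isUnit_det,
      isUnit_iff_ne_zero, ne_eq]
  rw [hset]
  exact isOpen_compl_singleton.preimage (continuous_aeval_charpoly.matrix_det)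

end Topology

/-- **At the block scalar point**: `χ_{u·1}(a·1) = (a − u)^{|o|}·1` is invertible when `a ≠ u`. [cite: Borel1991, III.9.1] -/
theorem isUnit_aeval_charpoly_smul_one {a u : K} (hau : a ≠ u) :
    IsUnit (aeval (a • (1 : Matrix m m K)) (u • (1 : Matrix o o K)).charpoly) := by
  have hev : ((u • (1 : Matrix o o K)).charpoly).eval a = (a - u) ^ Fintype.card o := by
    rw [Matrix.charpoly, ← Polynomial.coe_evalRingHom, RingHom.map_det]
    have hM : (evalRingHom a).mapMatrix (Matrix.charmatrix (u • (1 : Matrix o o K))) = (a - u) • (1 : Matrix o o K) := by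
      ext i j
      rw [RingHom.mapMatrix_apply, Matrix.map_apply, Matrix.smul_apply, Matrix.one_apply]
      by_cases hij : i = j
      · subst hij
        rw [Matrix.charmatrix_apply_eq, Matrix.smul_apply, Matrix.one_apply_eq, Polynomial.coe_evalRingHom, eval_sub, eval_X, eval_C,
          smul_eq_mul, mul_one, if_pos rfl, smul_eq_mul, mul_one]
      · rw [Matrix.charmatrix_apply_ne _ _ _ hij, Matrix.smul_apply, Matrix.one_apply_ne hij, smul_zero, Polynomial.coe_evalRingHom, eval_neg,
          eval_C, neg_zero, if_neg hij, smul_zero]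
    rw [hM, Matrix.det_smul, Matrix.det_one, mul_one]
  rw [← Algebra.algebraMap_eq_smul_one a, aeval_algebraMap_apply, coe_aeval_eq_eval, hev]
  exact ((sub_ne_zero.2 hau).isUnit.pow _).map _

/-! ## §3 Near `(ε, ε)`: intertwiners ∕ conjugators of block-diagonal matrices are block diagonal -/

section Eventually

variable [TopologicalSpace K] [IsTopologicalRing K] [T1Space K]

/-- **WEYL SEPARATION AT `ε = a·1 ⊕ u·1`, INTERTWINER FORM.** For `(M, M′)` near `(ε, ε)`: if `M`, `M′` are block diagonal and `y M = M′ y` then `y` is block diagonal.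
[cite: HornJohnson2013, §2.4.4 Cor. 2.4.4.2] [cite: Borel1991, III.9.1] [cite: Rogawski1990, §8.2 Prop. 8.2.1 p. 112] -/
theorem eventually_toBlocks_offDiag_eq_zero_of_mul_eq {a u : K} (hau : a ≠ u) :
    ∀ᶠ q : Matrix (m ⊕ o) (m ⊕ o) K × Matrix (m ⊕ o) (m ⊕ o) K in
        𝓝 (Matrix.fromBlocks (a • (1 : Matrix m m K)) 0 0 (u • (1 : Matrix o o K)), Matrix.fromBlocks (a • (1 : Matrix m m K)) 0 0 (u • (1 : Matrix o o K))),
      q.1.toBlocks₁₂ = 0 → q.1.toBlocks₂₁ = 0 → q.2.toBlocks₁₂ = 0 → q.2.toBlocks₂₁ = 0 →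
        ∀ y : Matrix (m ⊕ o) (m ⊕ o) K, y * q.1 = q.2 * y → y.toBlocks₁₂ = 0 ∧ y.toBlocks₂₁ = 0 := by
  -- the two open conditions `χ_{M₂₂}(M′₁₁)`, `χ_{M₁₁}(M′₂₂)` invertible, pulled back along the continuous block projections
  have hc₁ : Continuous fun q : Matrix (m ⊕ o) (m ⊕ o) K × Matrix (m ⊕ o) (m ⊕ o) K => (q.2.toBlocks₁₁, q.1.toBlocks₂₂) :=
    ((continuous_id.matrix_submatrix Sum.inl Sum.inl).comp continuous_snd).prodMk ((continuous_id.matrix_submatrix Sum.inr Sum.inr).comp continuous_fst)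
  have hc₂ : Continuous fun q : Matrix (m ⊕ o) (m ⊕ o) K × Matrix (m ⊕ o) (m ⊕ o) K => (q.2.toBlocks₂₂, q.1.toBlocks₁₁) :=
    ((continuous_id.matrix_submatrix Sum.inr Sum.inr).comp continuous_snd).prodMk ((continuous_id.matrix_submatrix Sum.inl Sum.inl).comp continuous_fst)
  have h₁ : (fun q : Matrix (m ⊕ o) (m ⊕ o) K × Matrix (m ⊕ o) (m ⊕ o) K => (q.2.toBlocks₁₁, q.1.toBlocks₂₂)) ⁻¹'
      {r : Matrix m m K × Matrix o o K | IsUnit (aeval r.1 r.2.charpoly)} ∈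
      𝓝 (Matrix.fromBlocks (a • (1 : Matrix m m K)) 0 0 (u • (1 : Matrix o o K)), Matrix.fromBlocks (a • (1 : Matrix m m K)) 0 0 (u • (1 : Matrix o o K))) := by
    refine hc₁.continuousAt.preimage_mem_nhds (isOpen_setOf_isUnit_aeval_charpoly.mem_nhds ?_)
    show IsUnit (aeval ((Matrix.fromBlocks (a • (1 : Matrix m m K)) 0 0 (u • (1 : Matrix o o K))).toBlocks₁₁)
        ((Matrix.fromBlocks (a • (1 : Matrix m m K)) 0 0 (u • (1 : Matrix o o K))).toBlocks₂₂).charpoly)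
    rw [Matrix.toBlocks_fromBlocks₁₁, Matrix.toBlocks_fromBlocks₂₂]
    exact isUnit_aeval_charpoly_smul_one hau
  have h₂ : (fun q : Matrix (m ⊕ o) (m ⊕ o) K × Matrix (m ⊕ o) (m ⊕ o) K => (q.2.toBlocks₂₂, q.1.toBlocks₁₁)) ⁻¹'
      {r : Matrix o o K × Matrix m m K | IsUnit (aeval r.1 r.2.charpoly)} ∈
      𝓝 (Matrix.fromBlocks (a • (1 : Matrix m m K)) 0 0 (u • (1 : Matrix o o K)), Matrix.fromBlocks (a • (1 : Matrix m m K)) 0 0 (u • (1 : Matrix o o K))) := by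
    refine hc₂.continuousAt.preimage_mem_nhds (isOpen_setOf_isUnit_aeval_charpoly.mem_nhds ?_)
    show IsUnit (aeval ((Matrix.fromBlocks (a • (1 : Matrix m m K)) 0 0 (u • (1 : Matrix o o K))).toBlocks₂₂)
        ((Matrix.fromBlocks (a • (1 : Matrix m m K)) 0 0 (u • (1 : Matrix o o K))).toBlocks₁₁).charpoly)
    rw [Matrix.toBlocks_fromBlocks₁₁, Matrix.toBlocks_fromBlocks₂₂]
    exact isUnit_aeval_charpoly_smul_one hau.symm
  filter_upwards [h₁, h₂] with q hq₁ hq₂ h12 h21 h12' h21' y hy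
  have hq1 : q.1 = Matrix.fromBlocks q.1.toBlocks₁₁ 0 0 q.1.toBlocks₂₂ := by
    conv_lhs => rw [← Matrix.fromBlocks_toBlocks q.1]
    rw [h12, h21]
  have hq2 : q.2 = Matrix.fromBlocks q.2.toBlocks₁₁ 0 0 q.2.toBlocks₂₂ := by
    conv_lhs => rw [← Matrix.fromBlocks_toBlocks q.2]
    rw [h12', h21']
  rw [hq1, hq2] at hy
  exact toBlocks_offDiag_eq_zero_of_mul_fromBlocks_eq hy hq₁ hq₂

/-- **WEYL SEPARATION AT `ε`, GROUP FORM**: for `(M, M′)` near `(ε, ε)` block diagonal and `y ∈ GL` with `y M y⁻¹ = M′`, `y` is block diagonal (`y ∈ Z(ε)`).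
[cite: HornJohnson2013, §2.4.4 Cor. 2.4.4.2] [cite: Borel1991, III.9.1] [cite: Rogawski1990, §8.2 Prop. 8.2.1 p. 112] -/
theorem eventually_conj_toBlocks_offDiag_eq_zero {a u : K} (hau : a ≠ u) :
    ∀ᶠ q : Matrix (m ⊕ o) (m ⊕ o) K × Matrix (m ⊕ o) (m ⊕ o) K in
        𝓝 (Matrix.fromBlocks (a • (1 : Matrix m m K)) 0 0 (u • (1 : Matrix o o K)), Matrix.fromBlocks (a • (1 : Matrix m m K)) 0 0 (u • (1 : Matrix o o K))),
      q.1.toBlocks₁₂ = 0 → q.1.toBlocks₂₁ = 0 → q.2.toBlocks₁₂ = 0 → q.2.toBlocks₂₁ = 0 →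
        ∀ y : GL (m ⊕ o) K, (y : Matrix (m ⊕ o) (m ⊕ o) K) * q.1 * ((y⁻¹ : GL (m ⊕ o) K) : Matrix (m ⊕ o) (m ⊕ o) K) = q.2 →
          (y : Matrix (m ⊕ o) (m ⊕ o) K).toBlocks₁₂ = 0 ∧ (y : Matrix (m ⊕ o) (m ⊕ o) K).toBlocks₂₁ = 0 := by
  filter_upwards [eventually_toBlocks_offDiag_eq_zero_of_mul_eq (m := m) (o := o) hau] with q hq h12 h21 h12' h21' y hy
  refine hq h12 h21 h12' h21' (y : Matrix (m ⊕ o) (m ⊕ o) K) ?_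
  rw [← hy, Matrix.mul_assoc, Matrix.mul_assoc, Units.inv_mul, Matrix.mul_one]

/-- **WEYL SEPARATION AT `ε`, FRAME FORM** (the shape the Rogawski files carry: an adapted frame `ε P = P · reindex e e (a·1 ⊕ u·1)`, cf. ★ `SingularLocalConjugacy`):
for `(M, M′)` near `(ε, ε)` with `M, M′ ∈ C(ε)` and ANY intertwiner `y M = M′ y` (in particular `y M y⁻¹ = M′`), `y ∈ C(ε)`.  (Pull back §3 along the continuous ring map
`Ψ : X ↦ reindex e⁻¹ e⁻¹ (P⁻¹ X P)`, which sends `ε ↦ a·1 ⊕ u·1` and `C(ε)` onto the block-diagonal matrices ★ `conj_eq_fromBlocks_of_commute`; back with ★ `commute_frame_fromBlocks`.)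
[cite: HornJohnson2013, §2.4.4 Cor. 2.4.4.2–2.4.4.3] [cite: Borel1991, III.9.1] [cite: Rogawski1990, §8.2 Prop. 8.2.1 p. 112] -/
theorem eventually_commute_of_mul_eq_of_frame {n : Type*} [Fintype n] [DecidableEq n] {a u : K} (hau : a ≠ u) {ε : Matrix n n K} (P : GL n K)
    (e : m ⊕ o ≃ n) (hP : ε * P.val = P.val * Matrix.reindex e e (Matrix.fromBlocks (a • (1 : Matrix m m K)) 0 0 (u • (1 : Matrix o o K)))) :
    ∀ᶠ q : Matrix n n K × Matrix n n K in 𝓝 (ε, ε),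
      Commute q.1 ε → Commute q.2 ε → ∀ y : Matrix n n K, y * q.1 = q.2 * y → Commute y ε := by
  -- Sylvester disjointness of the scalar blocks `a·1`, `u·1`
  have hAC : ∀ X : Matrix m o K, a • (1 : Matrix m m K) * X = X * (u • (1 : Matrix o o K)) → X = 0 := fun X hX => by
    rw [Matrix.smul_mul, Matrix.one_mul, Matrix.mul_smul, Matrix.mul_one, ← sub_eq_zero, ← sub_smul, smul_eq_zero] at hX
    exact hX.resolve_left (sub_ne_zero.2 hau)
  have hCA : ∀ Y : Matrix o m K, u • (1 : Matrix o o K) * Y = Y * (a • (1 : Matrix m m K)) → Y = 0 := fun Y hY => by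
    rw [Matrix.smul_mul, Matrix.one_mul, Matrix.mul_smul, Matrix.mul_one, ← sub_eq_zero, ← sub_smul, smul_eq_zero] at hY
    exact hY.resolve_left (sub_ne_zero.2 hau.symm)
  -- the frame map `Ψ`
  have hPP : (P⁻¹).val * P.val = 1 := by rw [← Units.val_mul, inv_mul_cancel, Units.val_one]
  have hPP' : P.val * (P⁻¹).val = 1 := by rw [← Units.val_mul, mul_inv_cancel, Units.val_one]
  set Ψ : Matrix n n K → Matrix (m ⊕ o) (m ⊕ o) K := fun X => Matrix.reindex e.symm e.symm ((P⁻¹).val * X * P.val) with hΨ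
  have hΨc : Continuous Ψ := ((continuous_const.mul continuous_id).mul continuous_const).matrix_submatrix _ _
  have hΨmul : ∀ X Y : Matrix n n K, Ψ (X * Y) = Ψ X * Ψ Y := fun X Y => by
    simp only [hΨ, ← Matrix.coe_reindexRingEquiv, ← map_mul]
    congr 1
    rw [Matrix.mul_assoc ((P⁻¹).val * X) P.val, ← Matrix.mul_assoc P.val, ← Matrix.mul_assoc P.val, hPP', Matrix.one_mul, Matrix.mul_assoc,
      Matrix.mul_assoc, Matrix.mul_assoc]
  have hΨε : Ψ ε = Matrix.fromBlocks (a • (1 : Matrix m m K)) 0 0 (u • (1 : Matrix o o K)) := by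
    simp only [hΨ]
    rw [Matrix.mul_assoc, hP, ← Matrix.mul_assoc, hPP, Matrix.one_mul]
    ext i j
    simp only [Matrix.reindex_apply, Matrix.submatrix_apply, Equiv.symm_symm, Equiv.symm_apply_apply]
  -- `C(ε)` goes to block-diagonal matrices
  have hΨcomm : ∀ X : Matrix n n K, Commute X ε → (Ψ X).toBlocks₁₂ = 0 ∧ (Ψ X).toBlocks₂₁ = 0 := fun X hX => by
    obtain ⟨B, D, -, -, hBD⟩ := conj_eq_fromBlocks_of_commute hP hAC hCA hX
    have hΨX : Ψ X = Matrix.fromBlocks B 0 0 D := by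
      simp only [hΨ]
      rw [hBD]
      ext i j
      simp only [Matrix.reindex_apply, Matrix.submatrix_apply, Equiv.symm_symm, Equiv.symm_apply_apply]
    rw [hΨX, Matrix.toBlocks_fromBlocks₁₂, Matrix.toBlocks_fromBlocks₂₁]
    exact ⟨rfl, rfl⟩
  -- pull back §3 along `Ψ × Ψ`
  have ht : Tendsto (fun q : Matrix n n K × Matrix n n K => (Ψ q.1, Ψ q.2)) (𝓝 (ε, ε))
      (𝓝 (Matrix.fromBlocks (a • (1 : Matrix m m K)) 0 0 (u • (1 : Matrix o o K)), Matrix.fromBlocks (a • (1 : Matrix m m K)) 0 0 (u • (1 : Matrix o o K)))) := by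
    rw [← hΨε]
    exact ((hΨc.comp continuous_fst).prodMk (hΨc.comp continuous_snd)).continuousAt
  filter_upwards [ht.eventually (eventually_toBlocks_offDiag_eq_zero_of_mul_eq (m := m) (o := o) hau)] with q hq h1 h2 y hy
  obtain ⟨h12, h21⟩ := hΨcomm q.1 h1
  obtain ⟨h12', h21'⟩ := hΨcomm q.2 h2
  have hyΨ : Ψ y * Ψ q.1 = Ψ q.2 * Ψ y := by rw [← hΨmul, ← hΨmul, hy]
  obtain ⟨hy12, hy21⟩ := hq h12 h21 h12' h21' (Ψ y) hyΨ
  -- `Ψ y` is block diagonal, hence commutes with `a·1 ⊕ u·1`; transport back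
  have hΨy : Ψ y = Matrix.fromBlocks (Ψ y).toBlocks₁₁ 0 0 (Ψ y).toBlocks₂₂ := by
    conv_lhs => rw [← Matrix.fromBlocks_toBlocks (Ψ y)]
    rw [hy12, hy21]
  have hback : y = P.val * Matrix.reindex e e (Matrix.fromBlocks (Ψ y).toBlocks₁₁ 0 0 (Ψ y).toBlocks₂₂) * (P⁻¹).val := by
    rw [← hΨy]
    simp only [hΨ]
    have hre : Matrix.reindex e e (Matrix.reindex e.symm e.symm ((P⁻¹).val * y * P.val)) = (P⁻¹).val * y * P.val := by
      ext i j
      simp only [Matrix.reindex_apply, Matrix.submatrix_apply, Equiv.symm_symm, Equiv.apply_symm_apply]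
    rw [hre, Matrix.mul_assoc, Matrix.mul_assoc, hPP', Matrix.mul_one, ← Matrix.mul_assoc, hPP', Matrix.one_mul]
  rw [hback]
  exact commute_frame_fromBlocks hP ((Commute.one_right _).smul_right a) ((Commute.one_right _).smul_right u)

end Eventually

end Literature.LinearAlgebra.Matrix
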